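import Literature.MathematicalPhysics.QuantumFieldTheory.Balaban1985CMP102.Binders

/-!
# `Balaban1985CMP102.BindersNewborn` — GAP binder G3D-08 `NewbornTerms45AsCited` of the lane `pub-balaban3d`:
# the bound (44)–(45) of T. Bałaban, *Ultraviolet stability of three-dimensional lattice pure gauge field
# theories*, Commun. Math. Phys. **102** (1985) 255–275 [Balaban1985UV3] (= [B10]) AS CITED for the terms of
# (41)_{k+1} BORN at step k from the normalising logarithm (61), at the chart level of the binder G3D-07
# `Binders.LogZLocalizedAsCited` (an ADDENDUM file: `Binders.lean` stays byte-stable; lane ruling R-46N′, 2026-08-22)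

HONEST FRAMING (PLAN.md §0).  Nothing of the series is asserted; this is ONE more printed input typed as a
hypothesis and consumed by name (prover seat p6's `newborn46_series`, the newborn slice of the lane's leaf (46)
`B10Assembly.LeafSystem.bound46`).  NOT a continuum limit, NOT infinite volume, NOT a mass gap, NOT d = 4, NOT Clay.
Page/line: «p. N Lm» = line m of the `lit read` text layer `p00(N−254).txt` of [B10] (its L1 is the running head);
the displays were read on the renders `…/b2b-balaban-ref1/pages/1985-cmp102-uv-stability-3d/…-p010/p011/p013-x2.png`.

WHAT [B10] PRINTS.  p. 266 L28–32, (43): «The expressions 𝒫_j(Y_j, U_k) are defined similarly to (35) ⟦sic: (34)⟧: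
Y_j = (y, c₁, …, c_n), where y represents big blocks of L^jη-lattice, contained in Ω_k, … and c_i are bonds in
Ω_k^{(j)}, …, 𝒫_j(Y_j, U_k) = ⟨𝒫_j(Y_j), B_k(c₁), …, B_k(c_n)⟩, n ≥ 2, B_k(c) = (1/i) log Ū_k^j(Γ_{y,c₋} ∪ c ∪
Γ_{c₊,y}), c ∈ Ω_k^{(j)}, |𝒫_j(Y_j)| ≤ O(1) Π_{i=1}^{n} exp(−κ₁(M₁L^jη)⁻¹|c_{i,−} − y|)» — for ALL `j = 1, …, k`,
hence also for the terms born at the last step; p. 267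
L2–6, (44): «The configuration U_k satisfies the following regularity condition on Ω_k: |U_k(∂p) − 1| <
2L²B₃g_{k−1}p(g_{k−1})η². This implies the condition |Ū_k^j(∂p′) − 1| < 4L²B₃g_{k−1}p(g_{k−1})(L^jη)² for p′ ⊂
Ω_k^{(j)}, and from (43) we get |𝒫_j(Y_j, U_k)| ≤ O(1) Π_{i=1}^{n} exp(−κ₁(M₁L^jη)⁻¹|c_{i,−} − y|) × (L^jη)⁻¹|c_{i,−}
− y| 8L²B₃g_{k−1}p(g_{k−1})(L^jη)²»; p. 267 L7–9, (45): «By the assumption n ≥ 2, summation over all Y_j with y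
fixed yields for g_{k−1} sufficiently small Σ_{Y_j : y = y₀} |𝒫_j(Y_j, U_k)| ≤ O(1)(O(M₁³)g_{k−1}p(g_{k−1}))²(L^jη)⁴»;
p. 267 L10–12, (46): «Summation over y gives the factor (M₁L^jη)⁻³|Λ_k|, and finally summation over j = 1, …, k
gives … ≤ O(1)M₁³g²_{k−1}p²(g_{k−1})|Λ_k|»; for the (61)-born terms p. 265 L14–16: «The term log Z^{(0)}(Ω₁, U₁) −
log Z^{(0)}(Ω₁, 1) can be decomposed in a similar way as the integral in (24), and we get an expression Σ_Y 𝒫₁(Y,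
U₁) which is identical to the expression on the right-hand side of (33), only the coefficients do not depend on
g₀»; the mechanism behind the kernels, p. 264 L19–25: «Thus we obtain expressions which are polynomials in B of at
least the second order, and at most the sixth order, localized in □₁. For each variable B(c) there is a sequence of
propagators connecting the bond c with the set X. They provide the exponential factor exp(−δ₀dist(c, X)). This
together with the exponential factor on the right-hand side of (25) give the factor exp(−κ₁M₁⁻¹|c₋ − y|), with
κ₁ = 1/7κ. We use the remaining exp(−κ₁𝓛(X)) to control a sum over all X contributing to a given monomial in
variables B.»

THE GAP (why a binder).  Print ASSERTS that the new terms have the form (43) with the kernel bound and derives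
(44)–(45) from it; for the (61)-born pieces the derivation of that form from [5] = [B9] Sect. E / (3.156), (3.183),
(3.185) «applied» is not in print (the same NOT-IN-PRINT-AS-APPLIED class as G3D-07).  The lane's chart data
(G3D-01/G3D-07: `Ψ_X` analytic on a ball of the sup-normed chart space with a sup bound, and (28) in its sup form
`‖B‖ ≤ cB·r(g_k)g_kp(g_k)`) provably give the (61)-born jets only at size `C63·(r(g_k)g_kp(g_k))²·e^{−κ𝓛(X)}`
(prover seat p6, `Summit…Proofs.NewbornJet.norm_jet26_le`: Cauchy's inequality), i.e. (45) TIMES `r(g_k)² = (1 + log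
g_k⁻¹)^{2r₀}`, not uniform in the number of steps; print's `g²p²` comes from the DISTANCE form of (28)/(44) «|B(c)| <
4L²|c₋ − y|g p» absorbed by the kernels of (43).  Hence (45) for these pieces is taken AS CITED, at the chart level
and in the currency of G3D-07 (amplitude `C63·e^{−κ𝓛(X)}`), per localization X — the form the step consumes.
-/

open Metric Set Finset

namespace Literature.MathematicalPhysics.QuantumFieldTheory.Balaban1985CMP102.BindersNewborn

open scoped Nat
open Literature.MathematicalPhysics.QuantumFieldTheory.Balaban1983to89
open Literature.MathematicalPhysics.QuantumFieldTheory.Balaban1985CMP102.Binders (LogZLocalizedAsCited)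

/-- **GAP binder G3D-08 — (44)–(45) AS CITED for the terms BORN at step k from (61)**, over the telescope of G3D-07
`Binders.LogZLocalizedAsCited T k E π ρ r₀ Cfar C63 κ logZU logZ1 Bcfg dom` and ITS pieces `Λ.Ψ`, `Λ.far` (no new
analytic data), with ONE constant `C45 ≥ 0`: for every localization `X`, history `h` and field `U`, the RETAINED
order-2…6 jet of the piece `Ψ_X` at the chart configuration `B_X(h, U)` of (27) minus its far monomials — the lane's
`Σ_{Y : X} 𝒫(Y, U_{k+1})` of (33)/(61) for the domain X, written with `iteratedFDeriv` exactly as prover seat p6's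
`Representation33.jet26` (`Σ_{n=2}^{6} (n!)⁻¹ DⁿΨ_X(0)[B, …, B]`, (30) p. 263) — is bounded by `C45·(g_kp(g_k))²·
C63·e^{−κ𝓛(X)}`: (45) p. 267 L7–9 «By the assumption n ≥ 2, summation over all Y_j with y fixed yields for g_{k−1}
sufficiently small Σ_{Y_j : y = y₀}|𝒫_j(Y_j, U_k)| ≤ O(1)(O(M₁³)g_{k−1}p(g_{k−1}))²(L^jη)⁴» at the top scale
(`L^jη = 1`; the `M₁`-power is carried by `C45`), from (44) p. 267 L5–6 and the form (43) p. 266 L28–32 «n ≥ 2,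
… |𝒫_j(Y_j)| ≤ O(1) Π_{i=1}^{n} exp(−κ₁(M₁L^jη)⁻¹|c_{i,−} − y|)», which print asserts for all j ≤ k, the
coefficients of the (61)-born terms being g-free (p. 265 L14–16).  `T.g k`, `T.b₀`, `T.p₀` are the tower's (no free
reals).  NOT IN PRINT as applied to the (61)-pieces (see the module docstring); consumed BY NAME by p6's
`newborn46_series` together with G3D-07. [cite: Balaban1985UV3, (44)–(45) p.267 L2–9 + (43) p.266 L28–32 + p.265 L14–16 + (34) p.264 L19–31] -/
structure NewbornTerms45AsCited (T : B10.TowerRun) (k : ℕ) {S : LocDomainSys}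
    (E : Type) [NormedAddCommGroup E] [NormedSpace ℂ E] {Γ : Type} (π : Γ → E →L[ℂ] E) (ρ r₀ Cfar C63 κ : ℝ)
    (logZU : T.Hist (k + 1) → T.Cfg (k + 1) → ℝ) (logZ1 : T.Hist (k + 1) → ℝ)
    (Bcfg : S.Dom → T.Hist (k + 1) → T.Cfg (k + 1) → E) (dom : T.Hist (k + 1) → Finset S.Dom)
    (Λ : LogZLocalizedAsCited T k E π ρ r₀ Cfar C63 κ logZU logZ1 Bcfg dom) (C45 : ℝ) : Prop where
  /-- the O(1) of (45) is a nonnegative constant -/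
  C45_nonneg : 0 ≤ C45
  /-- (45) at the top scale for the (61)-born pieces: retained jet minus far monomials of `Ψ_X` at `B_X(h,U)` is
  `≤ C45·(g_kp(g_k))²·C63·e^{−κ𝓛(X)}` -/
  jet45 : ∀ X h U,
    |(∑ n ∈ Finset.Ico 2 7, ((n ! : ℂ)⁻¹ • iteratedFDeriv ℂ n (Λ.Ψ X) 0 fun _ => Bcfg X h U)).re - Λ.far X h U|
      ≤ C45 * (T.g k * B10.pFun T.b₀ T.p₀ (T.g k)) ^ 2 * (C63 * Real.exp (-(κ * S.dj X)))

namespace NewbornTerms45AsCited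

variable {T : B10.TowerRun} {k : ℕ} {S : LocDomainSys} {E : Type} [NormedAddCommGroup E] [NormedSpace ℂ E]
  {Γ : Type} {π : Γ → E →L[ℂ] E} {ρ r₀ Cfar C63 κ : ℝ}
  {logZU : T.Hist (k + 1) → T.Cfg (k + 1) → ℝ} {logZ1 : T.Hist (k + 1) → ℝ}
  {Bcfg : S.Dom → T.Hist (k + 1) → T.Cfg (k + 1) → E} {dom : T.Hist (k + 1) → Finset S.Dom}
  {Λ : LogZLocalizedAsCited T k E π ρ r₀ Cfar C63 κ logZU logZ1 Bcfg dom} {C45 : ℝ}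

/-- **(45) summed over any finite set of localizations** («Summation over y gives the factor (M₁L^jη)⁻³|Λ_k|»,
p. 267 L10): `|Σ_{X ∈ s} (jet − far)| ≤ C45·(g_kp(g_k))²·Σ_{X ∈ s} C63·e^{−κ𝓛(X)}` — the form in which prover seat
p6 sums the newborn terms over the retained domains inside `B(Λ_{k+1}(h))` with the tree-decay sum of (25).
Bookkeeping over the binder. [cite: Balaban1985UV3, (45)–(46) p.267 L7–12] -/
theorem abs_sum_le (N : NewbornTerms45AsCited T k E π ρ r₀ Cfar C63 κ logZU logZ1 Bcfg dom Λ C45)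
    (s : Finset S.Dom) (h : T.Hist (k + 1)) (U : T.Cfg (k + 1)) :
    |∑ X ∈ s, ((∑ n ∈ Finset.Ico 2 7,
        ((n ! : ℂ)⁻¹ • iteratedFDeriv ℂ n (Λ.Ψ X) 0 fun _ => Bcfg X h U)).re - Λ.far X h U)|
      ≤ C45 * (T.g k * B10.pFun T.b₀ T.p₀ (T.g k)) ^ 2 * ∑ X ∈ s, C63 * Real.exp (-(κ * S.dj X)) := by
  rw [Finset.mul_sum]
  exact (Finset.abs_sum_le_sum_abs _ _).trans (Finset.sum_le_sum fun X _ => N.jet45 X h U)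

end NewbornTerms45AsCited

end Literature.MathematicalPhysics.QuantumFieldTheory.Balaban1985CMP102.BindersNewborn
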